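import Literature.NumberTheory.Automorphic.Liu2021.Def412AdmissibleIffParity        -- (E1 import) admissibility vocabulary
import Literature.AlgebraicGeometry.Liu2021.AdmissibleElement                       -- (E1 import) `IsAdmissibleElement`
import Literature.NumberTheory.QuadraticForms.PrescribedNormClassesCM               -- (E1 import)
import Literature.NumberTheory.Rogawski1990.CohomologicalFinComponentIsTheta        -- (E1 import) the (C♭)-telescope vocabulary (`rhoAtLine` frame data, `locF`, `epsOf`, …)
import Summits.HodgeConjecture.CorCM.B01.Transposition.Item6OmegaChiSplitting      -- (E1 import) `isCompatible_chiSplittingLine`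
import Summits.HodgeConjecture.HodgeConjecture.Theorems.F0P2lE3FlatOfArch           -- (E1 import)
import Summits.HodgeConjecture.HodgeConjecture.Theorems.F0P2fStubEPE3finGlobalEps   -- (E1 import)
import Summits.HodgeConjecture.HodgeConjecture.Theorems.F0P2fStubEBPinToAutomorphic -- ★ pin template + J1′ + (D)/(D̄) + carriers
import Summits.HodgeConjecture.HodgeConjecture.Theorems.F0P2aCohFormsContinuous     -- ★ `continuous_apply_of_mem_cohForms_cm`
import Summits.HodgeConjecture.HodgeConjecture.Theorems.F0P3HolProjectionReduction  -- ★ `compactSpace_automorphicQuotient_cm`, `four_le_finrank_of_two_le`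
import Summits.HodgeConjecture.HodgeConjecture.Theorems.F0P2cStubCI                 -- ★ `rhoAtLine_chi_isIrreducible` (general frame)
import Literature.NumberTheory.Automorphic.CMFrameHermitian                         -- ★ `transpose_map_cmConjRingHom_eq_of_frame`
import Summits.HodgeConjecture.HodgeConjecture.Theorems.F0P2OccGenCotangentOfOccursIn -- ED. 2: ★ p844131 p06 (g8) B1′ — §1 (frame packaging + the general-frame GIVEN-MEASURE twin) as a THEOREMS module
import Summits.HodgeConjecture.HodgeConjecture.Theorems.F0P2tThetaOccursInGenNeg  -- ED. 3: ★ p844949 (F0P2-p06 (g8) road A over ★ p844842 ∕ p844477): Θ-OCC-GEN hypothesis-free — the stub is CLOSED BY NAME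
import HarnessLib

/-!
# Crux `H413`, programme P2 — sub-line **OCC♭-GEN**: the theta calibration OCC♭∀ at an ARBITRARY CM frame and a GIVEN automorphic measure,
# from ONE measure-free letter in function currency (`stubOccFlatAll_of_gen : ‹OCC♭∀›` ⟸ Θ-OCC-GEN) — EDITION 3 «Θ-OCC-GEN PAID — SORRY-FREE»

Cell hodgecm-mathlib (D-0151), FLOOR 0, crux item H413 = stmt-HodgeConjecture-24833 (`HCCMUnconditional.H413`); programme P2 (`hdictE`), socket 27455
`F0HdictE` (road II′: E3♭ ⟸ {REL¹, OCC♭∀}, sub-line E3-RELSIGN `Cruxes/H413/Lines/F0_P2E3RelSign.lean` ED. 2 «ONE MEASURE» 55d99f43644bf3ac).  Author: desk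
F0P2-plan (g12) (PLAN-P2 v13 §2 + ERRATUM 1, superseded in shape by this edition's ERRATUM 2: ONE letter instead of (N)+(T)).  A LINES file: never
imported by another Lines file and importing none (the target is PASTED); since ED. 3 it has NO `sorry` (the stub `stub_thetaOccursInGen` is derived by name).
EDITION 2 (pen F0P2-p02 (g10) for the absent P2 desk, LEAD F0P3a-plan (g10) T9-24 (2) ∕ T9-34 (3) «p02 pens P2», 2026-09-01T12:24Z): §1 (the frame PACKAGING `cmFieldOf` ∕ `hermSpace3Of` ∕
`archFactorOfFrame` + the twin `exists_cotangentType_hasFinComponent_of_occursIn_cm`) now lives in the ★ THEOREMS module `Theorems/F0P2OccGenCotangentOfOccursIn.lean` (p844131,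
F0P2-p06 (g8) B1′, the ED. 1 §1 text VERBATIM) and is IMPORTED + `open`ed BY NAME here; §2 `OccTarget`, §3 `StubThetaOccursInGen` ∕ `stub_thetaOccursInGen`, §4
`occTarget_of_thetaOccursIn` ∕ `stubOccFlatAll_of_gen` are BYTE-IDENTICAL to ED. 1; sorry set unchanged = {`stub_thetaOccursInGen`}.
EDITION 3 (desk F0P2-plan (g13), 2026-09-01T16:2xZ, after #173 Θ-OCC-GEN closed ★ PROVED IN-HOUSE — ★ p844949 `Theorems/F0P2tThetaOccursInGenNeg.lean` ::
`thetaOccursInGen : ‹the §3 letter, ws-sha16 b50e296e47edd31f, token for token›`, hypothesis-free, TRIO; E1 `F0_P2E3RelSign` ED. 4 f803733e6fbc6c36 derives its own copy the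
same way): `stub_thetaOccursInGen := Summit.HodgeConjecture.HodgeConjecture.Cruxes.H413.F0P2tThetaOccursInGenNeg.thetaOccursInGen` — the line is SORRY-FREE and
RETIRED IN PLACE as a duplicate, kernel-checked carrier of OCC♭∀ ⟸ Θ-OCC-GEN (no registry row, no books row; §1–§2, the letter and §4 BYTE-IDENTICAL to ED. 2).
HC_CM is proved only modulo the printed citations until rung 0 closes; this file discharges no printed citation — it MOVES the open printed content of
OCC♭∀ (books #155′, director s843: «UNPROVED (L; measure-genericity owed in-house, P2 desk)») from automorphic-spectral currency (a discrete
`P ≤ L²(μA)` of cotangent type with `P.HasFinComponent ρ(a,χ)`, for EVERY automorphic measure `μA`) to FUNCTION currency («`ρ(a,χ)` occurs, by a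
non-zero equivariant map, in the cohomological cotangent forms of `U(H)`» — the global theta lift from `U(1)`, [GelbartRogawski1991, Prop. 3.1.1],
[Liu2021, Prop. 4.13 «Conversely»], [KonnoKonno2007, Thm. 5.4] ∕ [Liu2021, Lem. D.2]), where NO measure occurs; everything automorphic-spectral is ★.

THE CHAIN (every step a ★ declaration BY NAME; §1 is the general-frame, GIVEN-MEASURE twin of ★
`F0P2fStubEBPinToAutomorphic.exists_cotangentType_hasFinComponent_of_occursIn`, obtained by PACKAGING the frame `(L, ι, H, T, hT, hpos)` as pin data
`F := ⟨L⟩ : HodgeCM.CMField`, `V := ⟨H, hermitian (★ transpose_map_cmConjRingHom_eq_of_frame), ⟨T, hT⟩, hpos⟩ : HodgeCM.HermSpace3 F ι`,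
`𝔞 := ⟨cmArchSection, cmCompactFactor⟩ : ArchFactor F V` — `adelicDatum F V` is `adelicGroupData L⁺ L c̄ 3 H` and `cohForms 𝔞` is the generic
`CotangentForms.cohForms … (cmArchSection …) (cmCompactFactor …)` by `rfl`):
0. the letter Θ-OCC-GEN: a non-zero `θ : ω(a,χ) →ₗ (U(H)(𝔸_{L⁺}) → ℂ²)`, values in `cohForms (cmArchSection, cmCompactFactor)`, `ρ(a,χ)`-equivariant;
1. `ω(a,χ) ≠ 0` (★ `nontrivial_of_linearMap_ne_zero`) and `ρ(a,χ)` is IRREDUCIBLE at the general frame (★ `F0P2cStubCI.rhoAtLine_chi_isIrreducible`,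
   [Liu2021, Lem. D.1]; `ιV` onto by ★ `surjective_of_pinned`);
2. NO choice of measure: `μA` is the GIVEN one; the quotient is compact (★ `compactSpace_automorphicQuotient_cm`), cotangent forms are continuous
   (★ `continuous_apply_of_mem_cohForms_cm`);
3. J1′ ★ `F0P3SpectralJunction.exists_discreteAutomorphicRep_of_equivariant_cohForms` at `(F, V, 𝔞, μA)`: a discrete automorphic `P ≤ L²(μA)` with
   `P.HasFinComponent ρ(a,χ)`, not orthogonal to the class of a coordinate of a value `θ w`;
4. split `θ w ∈ cohForms = holCotForms ⊔ conj holCotForms`; the spectral-projection letters (D) ★ `F0P2dSocketD.holCotFormSpectralProjection_holds`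
   and (D̄) ★ `antiholCotFormSpectralProjection_of_hol` + ★ `exists_ne_zero_containsForm_of_classes` + ★ `orthogonalProjectionOnto_ne_zero` give
   `P.IsHolCotangentAt ∨ P.IsAntiholCotangentAt` at `(cmArchSection, cmCompactFactor)` (steps 3–4 = the pin proof VERBATIM at the packaged data).

BOOKS (preview for the director of record): `| III-101 (#155′) |` OCC♭∀ `StubOccFlatAdmissibleAll` ↦ CLOSED-DERIVED over {Θ-OCC-GEN `stub_thetaOccursInGen`
(new row, UNPROVED, L: [GelbartRogawski1991, Prop. 3.1.1] non-vanishing of the global theta lift of an admissible line + [KonnoKonno2007, Thm. 5.4] ∕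
[Liu2021, Lem. D.2] its holomorphic-cotangent `K_∞`-type + equivariance [Liu2021, Prop. 4.13 «Conversely» l. 2145–2149])} — count-neutral on UNPROVED,
measure-genericity obligation DISCHARGED by architecture (the letter has no measure).  Junction to E1: `OccTarget` is the body of
`…F0P2E3RelSign.StubOccFlatAdmissibleAll` token for token (ws-normalised sha16 70c2a2a489da080c both sides; a Lines file cannot import a Lines file, so the
`Iff.rfl` certificate is the referee's, over the E1 olean).

## References
* [GelbartRogawski1991] S. Gelbart, J. Rogawski, L-functions and Fourier–Jacobi coefficients for the unitary group U(3), Invent. Math. 105 (1991): §3.1 Prop. 3.1.1, §3.2.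
* [Liu2021] Y. Liu, Camb. J. Math. 9 (2021) = arXiv:2102.11518: Def. 4.11, Def. 4.12, Prop. 4.13 (l. 2131–2149), App. D Lem. D.1, Lem. D.2.
* [KonnoKonno2007] T. Konno, K. Konno, On doubling construction for real unitary dual pairs, Kyushu J. Math. 61 (2007) 35–82: Thm. 5.4 («K-type correspondence», p. 75) — the archimedean type of the U(1) → U(2,1) lift.
* [BorelJacquet1979] A. Borel, H. Jacquet, PSPM 33.1 (1979): §4.2, §4.6.  [Borel1997] A. Borel, CUP 1997: Thm. 2.13, §8.4.
* [BorelWallach2000] A. Borel, N. Wallach, 2nd ed. (2000): VII 3.2, XIII 1.2.  [PlatonovRapinchuk1994] §3.2 Thm 3.1, §5.1.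
-/

set_option autoImplicit false
set_option linter.dupNamespace false

noncomputable section

namespace Summit.HodgeConjecture.HodgeConjecture.Cruxes.H413.F0P2OccFlatGeneral

open scoped TensorProduct Matrix InnerProductSpace ENNReal ComplexOrder
open MeasureTheory
open NumberField NumberField.InfinitePlace IsDedekindDomain
open Literature.AlgebraicGeometry.ShimuraVarieties
open Literature.NumberTheory Literature.NumberTheory.Automorphic Literature.NumberTheory.Automorphic.UnitaryGroup
open Literature.NumberTheory.Automorphic.UnitaryGroup.CotangentForms (toQuotFun cmArchSection cmCompactFactor cohForms_le_smoothFun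
  isSmooth_of_equivariant_of_le_smoothFun holCotFormSpectralProjection antiholCotFormSpectralProjection antiholCotFormSpectralProjection_of_hol)
open Literature.NumberTheory.Automorphic.Liu2021 Literature.NumberTheory.Automorphic.Liu2021.AppendixC
open Literature.NumberTheory.Automorphic.Liu2021.Def411WeilCarriers
open Literature.NumberTheory.Automorphic.Liu2021.Def411WeilCarriersDoubling
open Literature.NumberTheory.Automorphic.IdeleClassGroup
open Literature.NumberTheory.GelbartRogawski1991 Literature.NumberTheory.GelbartRogawski1991.UnitaryDualPair
open Literature.NumberTheory.GelbartRogawski1991.UnitaryDualPair.WeilCoinv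
open Literature.RepresentationTheory Literature.RepresentationTheory.Liu2021
open Literature.NumberTheory.Rogawski1990
open Literature.NumberTheory.QuadraticForms
open Literature.AlgebraicGeometry.Liu2021 (IsAdmissibleElement exists_isAdmissibleElement_of_cmType)
open Summit.HodgeConjecture.CorCM
open Summit.HodgeConjecture.CorCM.Transposition
open Summit.HodgeConjecture.HodgeConjecture.Cruxes.H413.CohFormsCarriers
open Summit.HodgeConjecture.HodgeConjecture.Cruxes.H413.F0P3SpectralJunction
open Summit.HodgeConjecture.HodgeConjecture.Cruxes.H413.F0P3StubS5Fold (two_le_finrank_maximalRealSubfield exists_ne_zero_containsForm_of_classes)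
open Summit.HodgeConjecture.HodgeConjecture.Cruxes.H413.F0P3HilbertProjection (orthogonalProjectionOnto_ne_zero)
open Summit.HodgeConjecture.HodgeConjecture.Cruxes.H413.SpectrumJunction (continuous_toQuotFun cohForms_eq_generic compactSpace_automorphicQuotient_adelicDatum)
open Summit.HodgeConjecture.HodgeConjecture.Cruxes.H413.SpectrumInterfaces
open Summit.HodgeConjecture.HodgeConjecture.Cruxes.H413.F0P2dSocketD (holCotFormSpectralProjection_holds)
open Summit.HodgeConjecture.HodgeConjecture.Cruxes.H413.F0P2aCohFormsContinuous (continuous_apply_of_mem_cohForms_cm)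
open Summit.HodgeConjecture.HodgeConjecture.Cruxes.H413.F0P3HolProjectionReduction (compactSpace_automorphicQuotient_cm four_le_finrank_of_two_le)
open Summit.HodgeConjecture.HodgeConjecture.Cruxes.H413.F0P2fStubEBPinToAutomorphic (nontrivial_of_linearMap_ne_zero)
open Summit.HodgeConjecture.HodgeConjecture.Cruxes.H413.F0P2OccGenCotangentOfOccursIn (cmFieldOf hermSpace3Of archFactorOfFrame exists_cotangentType_hasFinComponent_of_occursIn_cm) -- ED. 2: §1 by name (★ p844131)

/-! ## §1 (ED. 2) — MOVED to ★ `Theorems/F0P2OccGenCotangentOfOccursIn.lean` (p844131): `cmFieldOf`, `hermSpace3Of`, `archFactorOfFrame`, the two `rfl` junctions and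
`exists_cotangentType_hasFinComponent_of_occursIn_cm`, imported and opened by name above (same statements, same proofs). -/

/-! ## §2 The target `OccTarget` := OCC♭∀ of E1 (`Cruxes/H413/Lines/F0_P2E3RelSign.lean` ED. 2 55d99f43644bf3ac :241–268), VERBATIM (ws-sha16 70c2a2a489da080c) -/

/-- **`OccTarget`** := the body of `…Cruxes.H413.F0P2E3RelSign.StubOccFlatAdmissibleAll` (ED. 2 «ONE MEASURE», :241–268), pasted token for token: for every CM frame,
every diagonal frame of the finite-adèlic group, EVERY automorphic measure `μA`, every weight-one conjugate-symplectic `μ`, every `⟨a⟩, χ` with `⟨a⟩`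
`μ`-admissible: a discrete automorphic `P ≤ L²(μA)` of (anti)holomorphic cotangent type at the frame with `P.HasFinComponent ρ(a,χ)`.
[cite: Liu2021, Prop. 4.13 (l. 2145–2149), Def. 4.12, App. D Lem. D.1] [cite: GelbartRogawski1991, Prop 3.1.1] -/
def OccTarget : Prop :=
  ∀ (L : Type) [Field L] [NumberField L] [IsCMField L] (ι : L →+* ℂ) (H : Matrix (Fin 3) (Fin 3) L) (T : GL (Fin 3) ℂ)
    (hT : (T : Matrix (Fin 3) (Fin 3) ℂ)ᴴ * H.map ι * (T : Matrix (Fin 3) (Fin 3) ℂ) = Literature.Geometry.ComplexHyperbolic.BallModel.J),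
    (∀ τ' : L →+* ℂ, InfinitePlace.mk τ' ≠ InfinitePlace.mk ι → (H.map τ').PosDef) → 2 ≤ Module.finrank ℚ ↥(maximalRealSubfield L) →
    ∀ {n' : ℕ} (e₁ : Fin 3 × Fin 1 ≃ Fin n') (dV : Fin 3 → L) (hdV : ∀ i, IsCMField.complexConj L (dV i) = dV i)
      (hdV0 : ∀ i, dV i ≠ 0) (g : GL (Fin 3) L)
      (hg : ((g : Matrix (Fin 3) (Fin 3) L).map (cmConjRingHom L))ᵀ * H * (g : Matrix (Fin 3) (Fin 3) L) = Matrix.diagonal dV)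
      (ιV : finAdelic (↥(maximalRealSubfield L)) L (IsCMField.complexConj L) 3 H →*
          finAdelic (↥(maximalRealSubfield L)) L (IsCMField.complexConj L) 3 (Matrix.diagonal dV)),
        (∀ k, ((ιV k : finAdelic (↥(maximalRealSubfield L)) L (IsCMField.complexConj L) 3 (Matrix.diagonal dV)) :
            GL (Fin 3) (FiniteAdeleRing (𝓞 L) L)) =
          (toFinAdeleGL L 3 g)⁻¹ * (k : GL (Fin 3) (FiniteAdeleRing (𝓞 L) L)) * toFinAdeleGL L 3 g) →
        ∀ (μA : Measure (adelicGroupData (↥(maximalRealSubfield L)) L (IsCMField.complexConj L) 3 H).automorphicQuotient)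
          [(adelicGroupData (↥(maximalRealSubfield L)) L (IsCMField.complexConj L) 3 H).IsAutomorphicMeasure μA],
        ∀ (μ : Literature.NumberTheory.Automorphic.IdeleClassGroup L →ₜ* Circle) (hμ : IsConjugateSymplectic L μ), HasWeight L μ 1 →
          ∀ (a : (↥(maximalRealSubfield L))ˣ) (χ : Chi (↥(maximalRealSubfield L)) L (IsCMField.complexConj L)),
            (∃ e : L, IsAdmissibleElement L hμ.cmType.1 e ∧
                epsOf (↥(maximalRealSubfield L)) (imagUnitSq L) L (2 * imagUnit L)⁻¹ e = locF (↥(maximalRealSubfield L)) (imagUnitSq L) a) →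
              ∃ (P : DiscreteAutomorphicRep (adelicGroupData (↥(maximalRealSubfield L)) L (IsCMField.complexConj L) 3 H) μA),
                (P.IsHolCotangentAt (cmArchSection L ι H T hT) (cmCompactFactor L ι H T hT) ∨ P.IsAntiholCotangentAt (cmArchSection L ι H T hT) (cmCompactFactor L ι H T hT)) ∧
                  P.HasFinComponent
                    (rhoAtLine (↥(maximalRealSubfield L)) L (IsCMField.complexConj L) 3 e₁ (Matrix.diagonal dV)
                      (complexConj_imagUnit L) (imagUnit_ne_zero L) (imagUnit_mul_self L) (realDiagonal_isSymm L dV hdV)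
                      (isUnit_det_realDiagonal L dV hdV hdV0) (realDiagonal_map L dV hdV).symm
                      (fun a => isCompatible_chiSplittingLine L e₁ dV hdV hdV0 (toHeckeCharacter L μ)
                        (isUnitary_toHeckeCharacter L μ) ((isOscillatorChar_toHeckeCharacter_iff μ).mpr hμ)
                        (TW (↥(maximalRealSubfield L)) a) (isSymm_TW (↥(maximalRealSubfield L)) a)
                        (isUnit_det_TW (↥(maximalRealSubfield L)) a) (JW (↥(maximalRealSubfield L)) L a)
                        (JW_eq (↥(maximalRealSubfield L)) L a)) ιV a χ)

/-! ## §3 The ONE letter of the line — Θ-OCC-GEN (function currency, measure-free; PAID at ED. 3 — ★ p844949 by name) -/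

/-- **stub Θ-OCC-GEN — `StubThetaOccursInGen`** [GelbartRogawski1991, Prop. 3.1.1] [Liu2021, Prop. 4.13 «Conversely» (l. 2145–2149), Lem. D.2]
[KonnoKonno2007, Thm. 5.4]: at every CM frame `(L, ι, H, T)` of signature `(2,1)` at `ι`, definite elsewhere, `[L⁺:ℚ] ≥ 2`, every diagonal
frame `(e₁, dV, g, ιV)` of the finite-adèlic group, every conjugate-symplectic `μ` of weight one, every line `⟨a⟩` and every `χ`: if `⟨a⟩` carries a
`μ`-ADMISSIBLE hermitian line (`∃ e` admissible with `ε(e) = locF a`), then the oscillator representation `ρ(a,χ) = rhoAtLine … ιV a χ` OCCURS in the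
cohomological cotangent forms of `U(H)` at the frame: there is a NON-ZERO `ℂ`-linear map `θ` from its space to `ℂ²`-valued functions on
`U(H)(𝔸_{L⁺})`, with values in `cohForms (cmArchSection, cmCompactFactor)`, intertwining `ρ(a,χ)` with right translation by `U(H)(𝔸_{L⁺,f})`
(the global theta lift of the `χ`-line paired with the `K_∞`-cotangent vectors).  NO automorphic measure occurs in this statement. -/
def StubThetaOccursInGen : Prop :=
  ∀ (L : Type) [Field L] [NumberField L] [IsCMField L] (ι : L →+* ℂ) (H : Matrix (Fin 3) (Fin 3) L) (T : GL (Fin 3) ℂ)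
    (hT : (T : Matrix (Fin 3) (Fin 3) ℂ)ᴴ * H.map ι * (T : Matrix (Fin 3) (Fin 3) ℂ) = Literature.Geometry.ComplexHyperbolic.BallModel.J),
    (∀ τ' : L →+* ℂ, InfinitePlace.mk τ' ≠ InfinitePlace.mk ι → (H.map τ').PosDef) → 2 ≤ Module.finrank ℚ ↥(maximalRealSubfield L) →
    ∀ {n' : ℕ} (e₁ : Fin 3 × Fin 1 ≃ Fin n') (dV : Fin 3 → L) (hdV : ∀ i, IsCMField.complexConj L (dV i) = dV i)
      (hdV0 : ∀ i, dV i ≠ 0) (g : GL (Fin 3) L)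
      (hg : ((g : Matrix (Fin 3) (Fin 3) L).map (cmConjRingHom L))ᵀ * H * (g : Matrix (Fin 3) (Fin 3) L) = Matrix.diagonal dV)
      (ιV : finAdelic (↥(maximalRealSubfield L)) L (IsCMField.complexConj L) 3 H →*
          finAdelic (↥(maximalRealSubfield L)) L (IsCMField.complexConj L) 3 (Matrix.diagonal dV)),
        (∀ k, ((ιV k : finAdelic (↥(maximalRealSubfield L)) L (IsCMField.complexConj L) 3 (Matrix.diagonal dV)) :
            GL (Fin 3) (FiniteAdeleRing (𝓞 L) L)) =
          (toFinAdeleGL L 3 g)⁻¹ * (k : GL (Fin 3) (FiniteAdeleRing (𝓞 L) L)) * toFinAdeleGL L 3 g) →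
        ∀ (μ : Literature.NumberTheory.Automorphic.IdeleClassGroup L →ₜ* Circle) (hμ : IsConjugateSymplectic L μ), HasWeight L μ 1 →
          ∀ (a : (↥(maximalRealSubfield L))ˣ) (χ : Chi (↥(maximalRealSubfield L)) L (IsCMField.complexConj L)),
            (∃ e : L, IsAdmissibleElement L hμ.cmType.1 e ∧
                epsOf (↥(maximalRealSubfield L)) (imagUnitSq L) L (2 * imagUnit L)⁻¹ e = locF (↥(maximalRealSubfield L)) (imagUnitSq L) a) →
              ∃ θ : (omegaAtLine (↥(maximalRealSubfield L)) L (IsCMField.complexConj L) 3 e₁ (Matrix.diagonal dV)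
                      (complexConj_imagUnit L) (imagUnit_ne_zero L) (imagUnit_mul_self L) (realDiagonal_isSymm L dV hdV)
                      (isUnit_det_realDiagonal L dV hdV hdV0) (realDiagonal_map L dV hdV).symm
                      (fun a => isCompatible_chiSplittingLine L e₁ dV hdV hdV0 (toHeckeCharacter L μ)
                        (isUnitary_toHeckeCharacter L μ) ((isOscillatorChar_toHeckeCharacter_iff μ).mpr hμ)
                        (TW (↥(maximalRealSubfield L)) a) (isSymm_TW (↥(maximalRealSubfield L)) a)
                        (isUnit_det_TW (↥(maximalRealSubfield L)) a) (JW (↥(maximalRealSubfield L)) L a)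
                        (JW_eq (↥(maximalRealSubfield L)) L a)) a χ) →ₗ[ℂ]
                    ((adelicGroupData (↥(maximalRealSubfield L)) L (IsCMField.complexConj L) 3 H).Adelic → (Fin 2 → ℂ)),
                θ ≠ 0 ∧
                (∀ w, θ w ∈ CotangentForms.cohForms (↥(maximalRealSubfield L)) L (IsCMField.complexConj L) 3 H
                    (cmArchSection L ι H T hT) (cmCompactFactor L ι H T hT)) ∧
                ∀ (k : ↥(finAdelic (↥(maximalRealSubfield L)) L (IsCMField.complexConj L) 3 H)) w,
                  θ (rhoAtLine (↥(maximalRealSubfield L)) L (IsCMField.complexConj L) 3 e₁ (Matrix.diagonal dV)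
                      (complexConj_imagUnit L) (imagUnit_ne_zero L) (imagUnit_mul_self L) (realDiagonal_isSymm L dV hdV)
                      (isUnit_det_realDiagonal L dV hdV hdV0) (realDiagonal_map L dV hdV).symm
                      (fun a => isCompatible_chiSplittingLine L e₁ dV hdV hdV0 (toHeckeCharacter L μ)
                        (isUnitary_toHeckeCharacter L μ) ((isOscillatorChar_toHeckeCharacter_iff μ).mpr hμ)
                        (TW (↥(maximalRealSubfield L)) a) (isSymm_TW (↥(maximalRealSubfield L)) a)
                        (isUnit_det_TW (↥(maximalRealSubfield L)) a) (JW (↥(maximalRealSubfield L)) L a)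
                        (JW_eq (↥(maximalRealSubfield L)) L a)) ιV a χ k w) =
                    fun x => θ w (x * finAdelicToAdelic (↥(maximalRealSubfield L)) L (IsCMField.complexConj L) 3 H k)

/-- stub Θ-OCC-GEN (the letter above) — **PAID (ED. 3)**: CLOSED BY NAME over ★ p844949, hypothesis-free. [cite: GelbartRogawski1991, Prop. 3.1.1] [cite: Liu2021, Prop. 4.13 l. 2145–2149, Lem. D.2]
[cite: KonnoKonno2007, Thm. 5.4 p. 75] -/
theorem stub_thetaOccursInGen : StubThetaOccursInGen :=
  Summit.HodgeConjecture.HodgeConjecture.Cruxes.H413.F0P2tThetaOccursInGenNeg.thetaOccursInGen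

/-! ## §4 The concluder: `OccTarget` from the one letter — sorry-free -/

set_option synthInstance.maxHeartbeats 400000 in
set_option maxHeartbeats 8000000 in
/-- **`occTarget_of_thetaOccursIn : StubThetaOccursInGen → OccTarget`.**  At the given frame and the GIVEN automorphic measure `μA`: the letter's
`θ` is non-zero, so the space of `ρ(a,χ)` is non-trivial (★ `nontrivial_of_linearMap_ne_zero`) and `ρ(a,χ)` is irreducible (★
`F0P2cStubCI.rhoAtLine_chi_isIrreducible`, [Liu2021, Lem. D.1]); the general-frame twin of the pin assembly (J1′ ★ + (D)/(D̄) ★) then yields a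
discrete automorphic `P ≤ L²(μA)` of (anti)holomorphic cotangent type with `P.HasFinComponent ρ(a,χ)`. -/
theorem occTarget_of_thetaOccursIn (hΘ : StubThetaOccursInGen) : OccTarget := by
  intro L _ _ _ ι H T hT hpos h2 n' e₁ dV hdV hdV0 g hg ιV hιV μA _ μ hμ hw a χ hadm
  obtain ⟨θ, hθ0, hθA, hθσ⟩ := hΘ L ι H T hT hpos h2 e₁ dV hdV hdV0 g hg ιV hιV μ hμ hw a χ hadm
  have hirr := F0P2cStubCI.rhoAtLine_chi_isIrreducible L H e₁ dV hdV hdV0 g hg ιV hιV μ hμ a χ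
  exact exists_cotangentType_hasFinComponent_of_occursIn_cm L ι H T hT hpos h2 μA _ hirr θ hθ0 hθA hθσ

/-- **THE LINE'S CONCLUDER `stubOccFlatAll_of_gen : OccTarget`** (= OCC♭∀ of E1 token for token) from the one letter. [cite: GelbartRogawski1991, Prop. 3.1.1]
[cite: Liu2021, Prop. 4.13] -/
theorem stubOccFlatAll_of_gen : OccTarget := occTarget_of_thetaOccursIn stub_thetaOccursInGen

end Summit.HodgeConjecture.HodgeConjecture.Cruxes.H413.F0P2OccFlatGeneral

end
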